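import Literature.NumberTheory.DiophantineGeometry.SuperellipticHeightsN
import HarnessLib

/-!
# Weil height of the ramification forms `N_c` of the family `t_c` on `r^e = x(1-x)`

`c`-parametric twin of `SuperellipticHeightsN.lean` ([GenEll] = S. Mochizuki, *Arithmetic elliptic
curves in general position*, Math. J. Okayama Univ. 52 (2010), Prop. 1.4 (i); abc-iut cell, route item
`Summit.ABC.ABC.Theses.IUTThetaPilot.GenEllTwo`, S6's plan GENELLTWO-P1ROUTE v2 §4, ruling #6
amendment (1): the family `t_c = 1/r + c·r^{k+1}/s`, `c ∈ ℚ^×`, package W4a). On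
`D_e : r^e = x(1-x)` (`e = 2k+1`, `e + 3 = 2m`, `s = 1 - 2x`) the form cutting out the ramification
divisor of `t_c` is `N_c = -s³ + c((k+1)·r^m − 2·r^{m+e})` (W5 coordinator w5-d045, 01:10:24Z:
`r²s³·∂_r G^c = 2c·r^{k+3}·s·N_c`); it has a pole of order `3e+3` at the point at infinity only. With
`z := 2N_c = -2s³ + c((e+1)·r^m − 4·r^{m+e})` and `c = P/D` (`P = num c`, `D = den c`):
`(D·z + 2D·s³)^e = P^e · (x(1-x))^m · ((e+1) − 4x(1-x))^e`, a weighted integral relation over `ℤ[x]`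
for `D·z` with weights `(wt x, wt z) = (e, 3e+3)` and full weighted degree of the constant term, so
L6-t16's two-sided weighted root bound applies:

* `exists_abs_logHeight₁_ramFormC_sub_le` — `|e·h_K(z) − (3e+3)·h_K(x)| ≤ C(e,c)·[K:ℚ]`;
* `exists_abs_logHeight₁_NC_sub_le` — the same for `N_c` itself, indexed by `k` (`e = 2k+1`);
* `exists_NC_ge_of_rat` — the one-sided shape `(6k+6)·h_L(x) ≤ (2k+1)·h_L(N_c) + [L:ℚ]·C₅`
  consumed as `hN` by `FibreConductor.inv_finrank_mul_sum_logNorm_le_slope` (W5d, p414883).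

Everything is proved; no definitions, no named facts; classical height theory (Bombieri–Gubler §2.5)
— nothing here refers to the disputed parts of the abc-iut corpus.
-/

noncomputable section

open Height Finset Polynomial Real
open Literature.NumberTheory.Transcendental

namespace Literature.NumberTheory.DiophantineGeometry

namespace Superelliptic

/-- The coefficient polynomials of the relation
`(α + 2D·s³)^e − P^e·(X − X²)^m·((e+1) − 4(X − X²))^e = 0` (`s = 1 − 2X`, `α = D·z`):
`a_k = binom(e,k)·(2D(1−2X)³)^{e−k}` for `0 < k`, `a_0 = (2D(1−2X)³)^e − P^e(X − X²)^m((e+1) − 4(X−X²))^e`;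
degree bounds `3(e−k)` resp. `= 3e+3` (`P ≠ 0`). [cite: MochizukiGenEll2010, Thm 2.1 proof p.11] -/
private theorem ramFormC_natDegree {e m : ℕ} (hem : e + 3 = 2 * m) (P D : ℤ) (hP : P ≠ 0) (k : ℕ) :
    ((fun k : ℕ => if k = 0 then ((C (2 * D) * (1 - C 2 * X) ^ 3) ^ e -
        C (P ^ e) * ((X - X ^ 2) ^ m * (C ((e : ℤ) + 1) - C 4 * (X - X ^ 2)) ^ e) : ℤ[X])
      else C (e.choose k : ℤ) * (C (2 * D) * (1 - C 2 * X) ^ 3) ^ (e - k)) k).natDegree ≤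
        (if k = 0 then 3 * e + 3 else 3 * (e - k)) ∧
    ((fun k : ℕ => if k = 0 then ((C (2 * D) * (1 - C 2 * X) ^ 3) ^ e -
        C (P ^ e) * ((X - X ^ 2) ^ m * (C ((e : ℤ) + 1) - C 4 * (X - X ^ 2)) ^ e) : ℤ[X])
      else C (e.choose k : ℤ) * (C (2 * D) * (1 - C 2 * X) ^ 3) ^ (e - k)) 0).natDegree
        = 3 * e + 3 := by
  -- adapted from L6-t16's `Superelliptic.ramForm_natDegree` (the case `P = D = 1`)
  have hs : (1 - C 2 * X : ℤ[X]).natDegree ≤ 1 := by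
    refine (natDegree_sub_le _ _).trans (max_le (by simp) ?_)
    exact (natDegree_C_mul_le _ _).trans (by simp)
  have hb : (C (2 * D) * (1 - C 2 * X) ^ 3 : ℤ[X]).natDegree ≤ 3 := by
    refine (natDegree_C_mul_le _ _).trans (natDegree_pow_le.trans ?_)
    simpa using Nat.mul_le_mul_left 3 hs
  have hbpow : ∀ n : ℕ, ((C (2 * D) * (1 - C 2 * X) ^ 3 : ℤ[X]) ^ n).natDegree ≤ 3 * n := fun n =>
    natDegree_pow_le.trans (by simpa [mul_comm] using Nat.mul_le_mul_left n hb)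
  have hXX : (X - X ^ 2 : ℤ[X]).natDegree = 2 := by
    rw [natDegree_sub_eq_right_of_natDegree_lt] <;> simp
  have hXX0 : (X - X ^ 2 : ℤ[X]) ≠ 0 := by
    intro h; rw [h, natDegree_zero] at hXX; exact absurd hXX (by norm_num)
  have h4 : (C 4 * (X - X ^ 2) : ℤ[X]).natDegree = 2 := by rw [natDegree_C_mul (by norm_num), hXX]
  have hq : (C ((e : ℤ) + 1) - C 4 * (X - X ^ 2) : ℤ[X]).natDegree = 2 := by
    rw [natDegree_sub_eq_right_of_natDegree_lt, h4]
    rw [h4, natDegree_C]; norm_num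
  have hq0 : (C ((e : ℤ) + 1) - C 4 * (X - X ^ 2) : ℤ[X]) ≠ 0 := by
    intro h; rw [h, natDegree_zero] at hq; exact absurd hq (by norm_num)
  have hsecond : (C (P ^ e) * ((X - X ^ 2) ^ m * (C ((e : ℤ) + 1) - C 4 * (X - X ^ 2)) ^ e) :
      ℤ[X]).natDegree = 3 * e + 3 := by
    rw [natDegree_C_mul (pow_ne_zero _ hP), natDegree_mul (pow_ne_zero _ hXX0) (pow_ne_zero _ hq0),
      natDegree_pow, natDegree_pow, hXX, hq]
    omega
  have ha0 : (((C (2 * D) * (1 - C 2 * X) ^ 3) ^ e -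
      C (P ^ e) * ((X - X ^ 2) ^ m * (C ((e : ℤ) + 1) - C 4 * (X - X ^ 2)) ^ e) : ℤ[X])).natDegree
        = 3 * e + 3 := by
    rw [natDegree_sub_eq_right_of_natDegree_lt, hsecond]
    rw [hsecond]; exact (hbpow e).trans_lt (by omega)
  refine ⟨?_, by simpa using ha0⟩
  by_cases hk0 : k = 0
  · subst hk0; simp only [↓reduceIte]; exact ha0.le
  · simp only [hk0, ↓reduceIte]
    exact (natDegree_C_mul_le _ _).trans (hbpow _)

/-- The weighted relation for `α = D·z`, `z = -2s³ + c((e+1)·r^m − 4·r^{m+e})`, `D·c = P`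
(`r^e = x(1-x)`, `s = 1 − 2x`): `α^e + Σ_{k<e} a_k(x) α^k = 0`, i.e.
`(α + 2D s³)^e = P^e (x(1-x))^m((e+1) − 4x(1-x))^e`. [cite: MochizukiGenEll2010, Thm 2.1 proof p.11] -/
private theorem ramFormC_rel {K : Type*} [Field K] {e m : ℕ} (he : 0 < e) {x r z c α : K} {P D : ℤ}
    (hr : r ^ e = x * (1 - x))
    (hz : z = -2 * (1 - 2 * x) ^ 3 + c * (((e : K) + 1) * r ^ m - 4 * r ^ (m + e)))
    (hcPD : (D : K) * c = P) (hα : α = (D : K) * z) :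
    α ^ e + ∑ k ∈ range e, aeval x ((fun k : ℕ => if k = 0 then ((C (2 * D) * (1 - C 2 * X) ^ 3) ^ e -
        C (P ^ e) * ((X - X ^ 2) ^ m * (C ((e : ℤ) + 1) - C 4 * (X - X ^ 2)) ^ e) : ℤ[X])
      else C (e.choose k : ℤ) * (C (2 * D) * (1 - C 2 * X) ^ 3) ^ (e - k)) k) * α ^ k = 0 := by
  -- adapted from L6-t16's `Superelliptic.ramForm_rel`
  set b : K := 2 * (D : K) * (1 - 2 * x) ^ 3 with hb
  have hbin : (α + b) ^ e = ∑ k ∈ range (e + 1), α ^ k * b ^ (e - k) * (e.choose k : K) :=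
    add_pow _ _ _
  have hval : (α + b) ^ e = (P : K) ^ e * ((x * (1 - x)) ^ m * (((e : K) + 1) - 4 * (x * (1 - x))) ^ e) := by
    have h1 : α + b = (P : K) * (r ^ m * (((e : K) + 1) - 4 * r ^ e)) := by
      rw [hα, hz, hb, ← hcPD, pow_add]; ring
    rw [h1, mul_pow, mul_pow, ← pow_mul, mul_comm m e, pow_mul, hr]
  have hev : ∀ k ∈ range e, aeval x ((fun k : ℕ => if k = 0 then
      ((C (2 * D) * (1 - C 2 * X) ^ 3) ^ e -
        C (P ^ e) * ((X - X ^ 2) ^ m * (C ((e : ℤ) + 1) - C 4 * (X - X ^ 2)) ^ e) : ℤ[X])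
      else C (e.choose k : ℤ) * (C (2 * D) * (1 - C 2 * X) ^ 3) ^ (e - k)) k) * α ^ k =
      α ^ k * b ^ (e - k) * (e.choose k : K) -
        (if k = 0 then (P : K) ^ e * ((x * (1 - x)) ^ m * (((e : K) + 1) - 4 * (x * (1 - x))) ^ e)
          else 0) := by
    intro k _
    have hC2 : aeval x (C 2 : ℤ[X]) = (2 : K) := by rw [aeval_C]; simp
    have hC4 : aeval x (C 4 : ℤ[X]) = (4 : K) := by rw [aeval_C]; simp
    have hCD : aeval x (C D : ℤ[X]) = (D : K) := by rw [aeval_C]; simp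
    have hCP : aeval x (C P : ℤ[X]) = (P : K) := by rw [aeval_C]; simp
    have hCe : aeval x (C ((e : ℤ) + 1) : ℤ[X]) = (e : K) + 1 := by rw [aeval_C]; simp
    have hCk : aeval x (C (e.choose k : ℤ) : ℤ[X]) = (e.choose k : K) := by rw [aeval_C]; simp
    by_cases hk0 : k = 0
    · subst hk0
      simp only [↓reduceIte, map_sub, map_pow, map_mul, map_one, aeval_X, hC2, hC4, hCD, hCP, hCe, hb,
        pow_zero, Nat.sub_zero, Nat.choose_zero_right, Nat.cast_one]
      ring
    · simp only [hk0, ↓reduceIte, map_sub, map_pow, map_mul, map_one, aeval_X, hC2, hCD, hCk, hb]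
      ring
  rw [Finset.sum_congr rfl hev, Finset.sum_sub_distrib, Finset.sum_ite_eq' (range e) 0,
    if_pos (mem_range.mpr he)]
  have hsplit : ∑ k ∈ range (e + 1), α ^ k * b ^ (e - k) * (e.choose k : K) =
      (∑ k ∈ range e, α ^ k * b ^ (e - k) * (e.choose k : K)) + α ^ e := by
    rw [Finset.sum_range_succ, Nat.sub_self, pow_zero, mul_one, Nat.choose_self, Nat.cast_one, mul_one]
  have key : α ^ e + (∑ k ∈ range e, α ^ k * b ^ (e - k) * (e.choose k : K)) =
      (P : K) ^ e * ((x * (1 - x)) ^ m * (((e : K) + 1) - 4 * (x * (1 - x))) ^ e) := by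
    rw [← hval, hbin, hsplit, add_comm]
  calc α ^ e + ((∑ k ∈ range e, α ^ k * b ^ (e - k) * (e.choose k : K)) -
        (P : K) ^ e * ((x * (1 - x)) ^ m * (((e : K) + 1) - 4 * (x * (1 - x))) ^ e))
      = (α ^ e + ∑ k ∈ range e, α ^ k * b ^ (e - k) * (e.choose k : K)) -
        (P : K) ^ e * ((x * (1 - x)) ^ m * (((e : K) + 1) - 4 * (x * (1 - x))) ^ e) := by ring
    _ = 0 := by rw [key]; ring

/-- **`r^e = x(1-x)`, `e + 3 = 2m`, `c = q ∈ ℚ^×`, `z = -2(1-2x)³ + c((e+1)·r^m − 4·r^{m+e})` (twice the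
ramification form `N_c` of the family `t_c`) ⟹ `|e·h_K(z) − (3e+3)·h_K(x)| ≤ C·[K:ℚ]`** for every
number field `K`, with `C` depending only on `e ≥ 1` and `q`: `z` has a pole of order `3e+3` at
infinity only, so its Weil height compares with `h(x)` with the sharp slope `(3e+3)/e` — [GenEll]
Prop. 1.4 (i) for `z, x : D_e → ℙ¹`, from the weighted relation
`(Dz + 2Ds³)^e = P^e(x−x²)^m((e+1) − 4(x−x²))^e` (`q = P/D`) and `|h(Dz) − h(z)| ≤ [K:ℚ]·log D`.
For `q = 1` this is L6-t16's `exists_abs_logHeight₁_ramForm_sub_le`. [cite: MochizukiGenEll2010, Prop 1.4 (i) p.6] -/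
theorem exists_abs_logHeight₁_ramFormC_sub_le {e m : ℕ} (he : 0 < e) (hem : e + 3 = 2 * m)
    (q : ℚ) (hq : q ≠ 0) :
    ∃ C : ℝ, ∀ (K : Type) [Field K] [NumberField K] (x r : K), r ^ e = x * (1 - x) →
      |(e : ℝ) * logHeight₁ (-2 * (1 - 2 * x) ^ 3 + (q : K) * (((e : K) + 1) * r ^ m - 4 * r ^ (m + e))) -
        (3 * e + 3) * logHeight₁ x| ≤ C * Module.finrank ℚ K := by
  set P : ℤ := q.num with hPdef
  set D : ℤ := (q.den : ℤ) with hDdef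
  have hP : P ≠ 0 := by rw [hPdef]; exact Rat.num_ne_zero.mpr hq
  set a : ℕ → ℤ[X] := fun k => if k = 0 then ((C (2 * D) * (1 - C 2 * X) ^ 3) ^ e -
        C (P ^ e) * ((X - X ^ 2) ^ m * (C ((e : ℤ) + 1) - C 4 * (X - X ^ 2)) ^ e) : ℤ[X])
      else C (e.choose k : ℤ) * (C (2 * D) * (1 - C 2 * X) ^ 3) ^ (e - k) with ha
  have hd : ∀ k < e, e * (a k).natDegree ≤ (3 * e + 3) * (e - k) := by
    intro k hk
    obtain ⟨h1, -⟩ := ramFormC_natDegree (e := e) hem P D hP k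
    rw [ha]
    by_cases hk0 : k = 0
    · subst hk0
      simp only [↓reduceIte] at h1 ⊢
      calc e * _ ≤ e * (3 * e + 3) := Nat.mul_le_mul_left e h1
        _ = (3 * e + 3) * (e - 0) := by rw [Nat.sub_zero, mul_comm]
    · simp only [hk0, ↓reduceIte] at h1 ⊢
      calc e * _ ≤ e * (3 * (e - k)) := Nat.mul_le_mul_left e h1
        _ ≤ (3 * e + 3) * (e - k) := by nlinarith
  have h0 : e * (a 0).natDegree = (3 * e + 3) * e := by
    rw [ha, (ramFormC_natDegree (e := e) hem P D hP 0).2, mul_comm]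
  obtain ⟨C₀, hC₀⟩ := WeightedRoot.exists_abs_sub_le_of_weighted he he a hd h0
  refine ⟨C₀ + e * Real.log q.den, fun K _ _ x r hr => ?_⟩
  set z : K := -2 * (1 - 2 * x) ^ 3 + (q : K) * (((e : K) + 1) * r ^ m - 4 * r ^ (m + e)) with hz
  have hD0 : (q.den : K) ≠ 0 := by exact_mod_cast q.den_nz
  have hcPD : (D : K) * (q : K) = P := by
    rw [hDdef, hPdef, Int.cast_natCast, mul_comm]
    exact_mod_cast Rat.mul_den_eq_num q
  have hrel := ramFormC_rel (P := P) (D := D) he hr hz hcPD rfl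
  have h := hC₀ K ((D : K) * z) x hrel
  rw [hDdef, Int.cast_natCast] at h
  -- `|h(D z) − h(z)| ≤ h(D) ≤ [K:ℚ]·log D`
  have hDh : logHeight₁ (q.den : K) ≤ Module.finrank ℚ K * Real.log q.den := by
    have h1 := mulHeight₁_natCast_le (K := K) q.den q.den_nz
    have hlog := Real.log_le_log (mulHeight₁_pos _) h1
    rw [Real.log_pow, NumberField.totalWeight_eq_finrank] at hlog
    exact hlog
  have hup : logHeight₁ ((q.den : K) * z) ≤ logHeight₁ (q.den : K) + logHeight₁ z :=
    logHeight₁_mul_le _ _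
  have hlow : logHeight₁ z ≤ logHeight₁ (q.den : K) + logHeight₁ ((q.den : K) * z) := by
    have h2 := logHeight₁_mul_le (q.den : K)⁻¹ ((q.den : K) * z)
    rwa [logHeight₁_inv, inv_mul_cancel_left₀ hD0] at h2
  have heR : (0 : ℝ) ≤ e := Nat.cast_nonneg _
  have hm1 := mul_le_mul_of_nonneg_left hup heR
  have hm2 := mul_le_mul_of_nonneg_left hlow heR
  have hm3 := mul_le_mul_of_nonneg_left hDh heR
  push_cast at h
  rw [abs_le] at h ⊢
  constructor
  · linarith [h.1, h.2]
  · linarith [h.1, h.2]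

/-- **The ramification form `N_c` itself** (`e = 2k+1`, `m = k+2`, `c = q ∈ ℚ^×`):
`|(2k+1)·h_K(N_c) − (6k+6)·h_K(x)| ≤ C(k,q)·[K:ℚ]` on `r^{2k+1} = x(1-x)`, where
`N_c = -(1-2x)³ + q((k+1)·r^{k+2} − 2·r^{3k+3})` (`2N_c = z` of the previous theorem,
`|h(2N_c) − h(N_c)| ≤ [K:ℚ]·log 2`). [cite: MochizukiGenEll2010, Prop 1.4 (i) p.6] -/
theorem exists_abs_logHeight₁_NC_sub_le (k : ℕ) (q : ℚ) (hq : q ≠ 0) :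
    ∃ C : ℝ, ∀ (K : Type) [Field K] [NumberField K] (x r : K), r ^ (2 * k + 1) = x * (1 - x) →
      |(2 * k + 1 : ℝ) * logHeight₁ (-(1 - 2 * x) ^ 3 +
          (q : K) * (((k : K) + 1) * r ^ (k + 2) - 2 * r ^ (3 * k + 3))) -
        (6 * k + 6) * logHeight₁ x| ≤ C * Module.finrank ℚ K := by
  obtain ⟨C, hC⟩ := exists_abs_logHeight₁_ramFormC_sub_le (e := 2 * k + 1) (m := k + 2)
    (by omega) (by omega) q hq
  refine ⟨C + (2 * k + 1) * Real.log 2, fun K _ _ x r hr => ?_⟩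
  set N : K := -(1 - 2 * x) ^ 3 + (q : K) * (((k : K) + 1) * r ^ (k + 2) - 2 * r ^ (3 * k + 3))
    with hN
  have h := hC K x r hr
  have hz : -2 * (1 - 2 * x) ^ 3 + (q : K) * ((((2 * k + 1 : ℕ) : K) + 1) * r ^ (k + 2) -
      4 * r ^ (k + 2 + (2 * k + 1))) = 2 * N := by
    rw [hN, show k + 2 + (2 * k + 1) = 3 * k + 3 by omega]; push_cast; ring
  rw [hz] at h
  have h2 : (2 : K) ≠ 0 := two_ne_zero
  have h2h : logHeight₁ (2 : K) ≤ Module.finrank ℚ K * Real.log 2 := by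
    have h1 := mulHeight₁_natCast_le (K := K) 2 two_ne_zero
    have hlog := Real.log_le_log (mulHeight₁_pos _) h1
    rw [Real.log_pow, NumberField.totalWeight_eq_finrank] at hlog
    exact_mod_cast hlog
  have hup : logHeight₁ (2 * N) ≤ logHeight₁ (2 : K) + logHeight₁ N := logHeight₁_mul_le _ _
  have hlow : logHeight₁ N ≤ logHeight₁ (2 : K) + logHeight₁ (2 * N) := by
    have h3 := logHeight₁_mul_le (2 : K)⁻¹ (2 * N)
    rwa [logHeight₁_inv, inv_mul_cancel_left₀ h2] at h3
  have hkR : (0 : ℝ) ≤ 2 * k + 1 := by positivity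
  have hm1 := mul_le_mul_of_nonneg_left hup hkR
  have hm2 := mul_le_mul_of_nonneg_left hlow hkR
  have hm3 := mul_le_mul_of_nonneg_left h2h hkR
  push_cast at h
  rw [abs_le] at h ⊢
  constructor
  · linarith [h.1, h.2]
  · linarith [h.1, h.2]

/-- **Consumer shape** (`hN` of `FibreConductor.inv_finrank_mul_sum_logNorm_le_slope`, W5d): for
`e = 2k+1` and fixed `c = q ∈ ℚ^×`, `(6k+6)·h_L(x) ≤ (2k+1)·h_L(N_c) + [L:ℚ]·C₅` on
`r^{2k+1} = x(1-x)`, `N_c = -(1-2x)³ + q((k+1)·r^{k+2} − 2·r^{3k+3})`.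
[cite: MochizukiGenEll2010, Prop 1.4 (i) p.6] -/
theorem exists_NC_ge_of_rat (k : ℕ) (q : ℚ) (hq : q ≠ 0) :
    ∃ C₅ : ℝ, ∀ (L : Type) [Field L] [NumberField L] (x r : L), r ^ (2 * k + 1) = x * (1 - x) →
      (6 * k + 6 : ℝ) * logHeight₁ x ≤
        (2 * k + 1 : ℝ) * logHeight₁ (-(1 - 2 * x) ^ 3 +
          (q : L) * (((k : L) + 1) * r ^ (k + 2) - 2 * r ^ (3 * k + 3))) + Module.finrank ℚ L * C₅ := by
  obtain ⟨C, hC⟩ := exists_abs_logHeight₁_NC_sub_le k q hq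
  refine ⟨C, fun L _ _ x r hr => ?_⟩
  have h := (abs_le.mp (hC L x r hr)).1
  linarith

end Superelliptic

end Literature.NumberTheory.DiophantineGeometry

end
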